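import Summits.CriticalPhenomena.CardyFormulaZ2.Theorems.CardyComplexConeEdgeCoherenceHarmonicSplitMorera
import Summits.CriticalPhenomena.CardyFormulaZ2.Theses.CardySusyWard

/-!
# Cross-route glue: the alternating `ℤ₄`-mode piece of `EdgeCoherence`'s harmonic split closes
# `CardySusyWard.WeakHolomorphy`, and the crux IS the weak alternating-mode law

Crux `CardySusyWard.WeakHolomorphy` (stmt-CriticalPhenomena-11292; the weak dual half of discrete Cauchy–Riemann
for the `q = 1`, spin-`1/3` parafermionic vertex observable of critical bond percolation on `δℤ²`), line `Sketch`,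
lead c7 (infrastructure, `--supports`).

The sibling route `CardyComplexCone` splits its rank-2 crux `EdgeCoherence` (stmt-CriticalPhenomena-11385) into
three typed pieces (`Theorems/CardyComplexConeEdgeCoherenceHarmonicSplit.lean`): lattice-scale same-class regularity,
the alternating mode `AlternatingModeNull` (`H₂(v) = E₀ − E₁ + E₂ − E₃ = o(δ^{1/3})` locally uniformly, `E_c` the four
corner values of the spin-`1/3` corner observable at the primal vertex `v`) and the chiral mode.  This file records,
over the LANDED stubs of the proved sibling crux `CoherentMorera` (stmt-CriticalPhenomena-11388: `stub_pairingBound`,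
`stub_kirchhoff`, `stub_traceIdentity`, `stub_siteRegrouping`) and `scaledNull_P2_of_alternatingModeNull`
(`…HarmonicSplitMorera`), that

* `AlternatingModeNull → WeakHolomorphy` (`weakHolomorphy_of_alternatingModeNull`): the alternating piece ALONE closes
  this crux — no lattice regularity, no chiral mode, no envelope (`EdgePrecompact`) and none of the three Hausdorff
  hypotheses of the family form are used;
* per family and test function, the crux's pairing `δ^{5/3} Σ_z F_δ(z) ∂̄φ(z_δ)` is null iff the `A₂`-pairing
  `δ^{5/3} Σ_v A₂(E_δ)(v) ∂φ(δv)` is null (`tendsto_iff_scaledNull_P2`), whence the normal form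
  `weakHolomorphy_iff_weakAlternatingMode`: the crux is EXACTLY the weak
  (`∂φ`-tested) law of the alternating `ℤ₄`-mode of the corner observable — the pointwise piece `AlternatingModeNull` is
  the same statement made locally uniform.

So the two routes' open rank-2 statements meet in ONE typed piece: `AlternatingModeNull` implies this crux (here) and,
with `EdgePrecompact`, both conclusions of `CoherentMorera` (`coherentMoreraConclusion_of_alternatingModeNull`); the
earlier cross-route glue `stub_weakHolomorphyOfEdgeCoherence` (EdgeCoherence → WeakHolomorphy, p137566) factors through it
only informally (EdgeCoherence is not known to imply `AlternatingModeNull` without the lattice regularity).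
References: Duminil-Copin–Smirnov, arXiv:1109.1549, §8.3 (Prop. 8.6, Conj. 8.7); Duminil-Copin, arXiv:1208.3787, Prop. 4.
-/

noncomputable section

namespace Summit.CriticalPhenomena.CardyFormulaZ2.Theorems.WeakHolomorphy.CrossRoute

open scoped BigOperators Topology
open Filter Set MeasureTheory
open _root_.Literature.Probability.LatticeModels
open _root_.Literature.Probability.RandomPlanarGeometry (DobrushinDomain)
open Summit.CriticalPhenomena.CardyFormulaZ2.Cruxes.CoherentMorera.FinitaryGreenPairing
open Summit.CriticalPhenomena.CardyFormulaZ2.Cruxes.EdgeCoherence.HarmonicSplit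
  (AlternatingModeNull scaledNull_P2_of_alternatingModeNull)
open Summit.CriticalPhenomena.CardyFormulaZ2.Theses.CardySusyWard (WeakHolomorphy)

/-! ## Elementary filter algebra: the spin-shift pairing ties `P₀` and `P₂` -/

/-- If `δ^{5/3}(P_a − i·P_b) → 0` then `δ^{5/3}P_a → 0 ↔ δ^{5/3}P_b → 0`. [folklore] -/
theorem scaledNull_iff_of_sub {Pa Pb : ℝ → ℂ}
    (hA : Tendsto (fun δ : ℝ => ((δ ^ ((5:ℝ) / 3) : ℝ) : ℂ) * (Pa δ - Complex.I * Pb δ))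
      (𝓝[>] (0:ℝ)) (𝓝 0)) :
    ScaledNull Pa ↔ ScaledNull Pb := by
  refine ⟨fun h => ?_, fun h => scaledNull_of_sub_of_or hA (Or.inr h)⟩
  unfold ScaledNull at h ⊢
  have h2 := ((h.sub hA).const_mul (-Complex.I))
  rw [sub_zero, mul_zero] at h2
  refine h2.congr' (Eventually.of_forall fun δ => ?_)
  have hI : Complex.I * Complex.I = -1 := Complex.I_mul_I
  linear_combination (-((((δ ^ ((5:ℝ) / 3) : ℝ) : ℂ)) * Pb δ)) * hI

/-- **Per family and test function: the crux's vertex pairing is `δ^{5/3}`-null iff the `A₂`-pairing is.**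
Along a guarded family `Λ` of `D` and for an admissible test function `φ`:
`δ^{5/3} Σ_z F_δ(z) ∂̄φ(z_δ) → 0 ↔ δ^{5/3} Σ_v A₂(E_δ)(v) ∂φ(δv) → 0`, by site regrouping under the trace identity
(`P_V ↔ P₀`) and the spin-shift pairing `δ^{5/3}(P₀ − iP₂) → 0` (summation by parts + Kirchhoff's vertex relation).
[cite: DuminilCopin2012Parafermion, Proposition 4] -/
theorem tendsto_iff_scaledNull_P2 (D : DobrushinDomain) (Λ : ℝ → DiscreteDobrushin) (hG : Guards D Λ)
    (φ : ℂ → ℂ) (hT : TestFn D φ) :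
    ScaledNull (PV Λ φ) ↔ ScaledNull (P2 Λ φ) :=
  (stub_siteRegrouping D Λ hG (stub_traceIdentity D Λ hG) φ hT).trans
    (scaledNull_iff_of_sub (spinShift_of stub_pairingBound stub_kirchhoff D Λ hG φ hT))

/-! ## The alternating piece alone closes the crux -/

/-- **Cross-route implication `AlternatingModeNull → WeakHolomorphy`.** The pointwise alternating-mode law of
the sibling split (`H₂ = o(δ^{1/3})` locally uniformly) implies the crux: `δ^{5/3}P₂ → 0` by the lattice-point count
(`scaledNull_P2_of_alternatingModeNull`), then `tendsto_iff_scaledNull_P2`.  CONDITIONAL on an open piece of the sibling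
crux; credits nothing by itself.  The three Hausdorff hypotheses of the family form are not used.
[cite: DuminilCopinSmirnov2012Lattice, Conjecture 8.7] -/
theorem weakHolomorphy_of_alternatingModeNull : AlternatingModeNull → WeakHolomorphy := by
  intro h2 D Λ hΩ hδ _hA _hB _hab hadm φ hφ hsupp hsub
  have hG : Guards D Λ := ⟨hΩ, hδ, hadm⟩
  have hT : TestFn D φ := ⟨hφ, hsupp, hsub⟩
  exact (tendsto_iff_scaledNull_P2 D Λ hG φ hT).2 (scaledNull_P2_of_alternatingModeNull h2 D Λ hG φ hT)

/-! ## The crux IS the weak alternating-mode law -/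

/-- **Normal form: `WeakHolomorphy ↔` the weak alternating-mode law.** The crux is EXACTLY the statement that,
along every admissible family of every Dobrushin domain and for every smooth compactly supported test function,
`δ^{5/3} · Σ_v A₂(E_δ)(v) · ∂φ(δ v) → 0` (`ScaledNull (P2 Λ φ)`; `A₂(E)(v) = E(v,v) − E(v,v−e₀) + E(v,v−e₀−e₁) − E(v,v−e₁)`
the alternating `ℤ₄`-mode of the spin-`1/3` corner observable at the lattice site `v`, `∂φ = (∂_xφ − i∂_yφ)/2`) — the weak
(`∂φ`-tested) law of the alternating mode at rate `o(δ^{-5/3})`; its pointwise, locally uniform version is the sibling piece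
`AlternatingModeNull`.  The crux's binders are carried verbatim (the three Hausdorff hypotheses are idle on both sides).
[cite: DuminilCopinSmirnov2012Lattice, Conjecture 8.7] -/
theorem weakHolomorphy_iff_weakAlternatingMode : WeakHolomorphy ↔
    ∀ (D : DobrushinDomain) (Λ : ℝ → DiscreteDobrushin), (∀ δ, (Λ δ).Ω = D.carrier) → (∀ δ, (Λ δ).δ = δ) →
      Tendsto (fun δ : ℝ => Metric.hausdorffEDist (Λ δ).arcA (D.arc 0)) (𝓝[>] 0) (𝓝 0) →
      Tendsto (fun δ : ℝ => Metric.hausdorffEDist (Λ δ).arcB (D.arc 1)) (𝓝[>] 0) (𝓝 0) →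
      Tendsto (fun δ : ℝ => Metric.hausdorffEDist (medialPoint δ '' (Λ δ).zdABEdges) {D.pt 0, D.pt 1})
        (𝓝[>] 0) (𝓝 0) →
      (∀ᶠ δ in 𝓝[>] (0:ℝ), (Λ δ).IsZdAdmissible) →
      ∀ φ : ℂ → ℂ, ContDiff ℝ (⊤ : ℕ∞) φ → HasCompactSupport φ → tsupport φ ⊆ D.carrier →
        ScaledNull (P2 Λ φ) := by
  constructor
  · intro h D Λ hΩ hδ hA hB hab hadm φ hφ hsupp hsub
    exact (tendsto_iff_scaledNull_P2 D Λ ⟨hΩ, hδ, hadm⟩ φ ⟨hφ, hsupp, hsub⟩).1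
      (h D Λ hΩ hδ hA hB hab hadm φ hφ hsupp hsub)
  · intro h D Λ hΩ hδ hA hB hab hadm φ hφ hsupp hsub
    exact (tendsto_iff_scaledNull_P2 D Λ ⟨hΩ, hδ, hadm⟩ φ ⟨hφ, hsupp, hsub⟩).2
      (h D Λ hΩ hδ hA hB hab hadm φ hφ hsupp hsub)

/-- **The weak alternating-mode law without the Hausdorff hypotheses follows from `AlternatingModeNull`**
(pointwise ⟹ weak, by the lattice-point count; guards only). [cite: DuminilCopinSmirnov2012Lattice, Conjecture 8.7] -/
theorem weakAlternatingMode_of_alternatingModeNull (h2 : AlternatingModeNull) (D : DobrushinDomain)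
    (Λ : ℝ → DiscreteDobrushin) (hΩ : ∀ δ, (Λ δ).Ω = D.carrier) (hδ : ∀ δ, (Λ δ).δ = δ)
    (hadm : ∀ᶠ δ in 𝓝[>] (0:ℝ), (Λ δ).IsZdAdmissible) (φ : ℂ → ℂ) (hφ : ContDiff ℝ (⊤ : ℕ∞) φ)
    (hsupp : HasCompactSupport φ) (hsub : tsupport φ ⊆ D.carrier) : ScaledNull (P2 Λ φ) :=
  scaledNull_P2_of_alternatingModeNull h2 D Λ ⟨hΩ, hδ, hadm⟩ φ ⟨hφ, hsupp, hsub⟩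

/-! ## Registered one-line forms (stubs of stmt-CriticalPhenomena-11292) -/

/-- **Registered form of `weakHolomorphy_of_alternatingModeNull`**: the alternating `ℤ₄`-mode piece of the sibling
crux's harmonic split ALONE implies the crux `WeakHolomorphy` (conditional glue; credits nothing by itself).
[cite: DuminilCopinSmirnov2012Lattice, Conjecture 8.7] -/
theorem stub_weakHolomorphyOfAlternatingModeNull : AlternatingModeNull → WeakHolomorphy :=
  weakHolomorphy_of_alternatingModeNull

/-- **Registered form of `weakHolomorphy_iff_weakAlternatingMode`**: the crux IS the weak (`∂φ`-tested)
alternating-mode law `δ^{5/3}·Σ_v A₂(E_δ)(v)·∂φ(δv) → 0` along every admissible family, for every test function.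
[cite: DuminilCopinSmirnov2012Lattice, Conjecture 8.7] -/
theorem stub_weakHolomorphyIffWeakAlternatingMode : WeakHolomorphy ↔ ∀ (D : DobrushinDomain) (Λ : ℝ → DiscreteDobrushin), (∀ δ, (Λ δ).Ω = D.carrier) → (∀ δ, (Λ δ).δ = δ) → Tendsto (fun δ : ℝ => Metric.hausdorffEDist (Λ δ).arcA (D.arc 0)) (𝓝[>] 0) (𝓝 0) → Tendsto (fun δ : ℝ => Metric.hausdorffEDist (Λ δ).arcB (D.arc 1)) (𝓝[>] 0) (𝓝 0) → Tendsto (fun δ : ℝ => Metric.hausdorffEDist (medialPoint δ '' (Λ δ).zdABEdges) {D.pt 0, D.pt 1}) (𝓝[>] 0) (𝓝 0) → (∀ᶠ δ in 𝓝[>] (0:ℝ), (Λ δ).IsZdAdmissible) → ∀ φ : ℂ → ℂ, ContDiff ℝ (⊤ : ℕ∞) φ → HasCompactSupport φ → tsupport φ ⊆ D.carrier → ScaledNull (P2 Λ φ) :=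
  weakHolomorphy_iff_weakAlternatingMode

end Summit.CriticalPhenomena.CardyFormulaZ2.Theorems.WeakHolomorphy.CrossRoute

end
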